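import Summits.ResolutionOfSingularities.ResolutionOfSingularities.Theorems.PurelyInseparableDim4ZooCertSelfReproducing33
import Summits.ResolutionOfSingularities.ResolutionOfSingularities.Theorems.PurelyInseparableDim4PhiLineIsolation
import Summits.ResolutionOfSingularities.ResolutionOfSingularities.Theorems.PurelyInseparableDim4ResConeTransport
import Summits.ResolutionOfSingularities.ResolutionOfSingularities.Theorems.PurelyInseparableDim4CleaningDisjoint
import Summits.ResolutionOfSingularities.ResolutionOfSingularities.Theorems.PurelyInseparableDim4CoordinateTrap
import Literature.AlgebraicGeometry.Resolution.PointBlowupIFPGiraud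
import HarnessLib

/-!
# BLIND FIXED POINTS OF THE POINT BLOW-UP AT EVERY EXPONENT `q ≥ 2`, over every field
# (cell `res-dim4-pi`, ZOO board; desk WORD #136 (a) (β), seat res-dim4-p-4 g3 — «ZOO companion uniform in q»)

[OURS · ZOO / census value only · TIER-2 · counted 0 · AI kernel work, weaker than expert review.]  Nothing here
is a statement about F4-C (`TerminatesInScope`), and nothing here proves or refutes resolution of singularities in
dimension `≥ 4` / characteristic `p`.

`…ZooCertSelfReproducing33` certified res-dim4-eng-w5 g2's `(3,3)` specimen `x₃(x₁² + g²)`, `g = x₂ − x₄ + x₂x₄`, by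
`decide` over `𝔽₃`.  The mechanism is uniform in the exponent and in the field: for EVERY `n ≥ 1` (exponent `q = n + 1`)
and EVERY field `K`, the presented state

  `s_n = (A_n, r = 0, exc = {x₂})`, `A_n = x₃ · (x₁ⁿ + gⁿ)`, `g = x₂ − x₄ + x₂x₄`  (`(x₁,x₂,x₃,x₄) = Fin 4`)

satisfies

* §2 `A_n ∈ Q^{n+1}` for `Q = (x₁, x₃, g)`, `ord₀ A_n = n + 1` (`ordAlong_univ_A`), no monomial of degree `≤ n`;
* §3 **the point is the ONLY Hironaka-permissible coordinate centre** (`eq_univ_of_isPermissibleCentre`; witnesses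
  `x₃x₁ⁿ`, `x₃x₂ⁿ`, `x₃x₄ⁿ` with coefficients `1, 1, (−1)ⁿ`);
* §4 **self-reproduction letter for letter**: in the `x₂`-chart of the point blow-up the transform is
  `x₃(x₁ⁿ + (1 − x₄ + x₂x₄)ⁿ)` (`chartTransform_A`, via `PointBlowup.X_pow_mul_chartTransform`: the total transform is
  `x₂^{n+1}·` that), the translation `x₄ ↦ x₄ + 1` restores `A_n` (`translate_A'`), cleaning is inert (every monomial has
  `x₃`-exponent `1`; `deletePthPowers_A`), the fibre point `(0,0,0,1)` is equimultiple, and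
  **`step_s : CentreBlowup.step (n+1) univ x₂ (0,0,0,1) s_n = s_n`**; hence a `Step0`, `Step1h` and `StepRule R` loop for every
  permissible coordinate rule `R`, and `{s_n}` is a one-state `IsTrap (n+1)` (`isTrap_singleton`);
* part 2 (`…BlindFixedPointsScope`): OUT of coordinate scope from move 0 (`not_inCoordinateScope_A`), the headline
  `exists_blind_fixedPoint (K) (hq : 2 ≤ q)` and the link with eng-w5's `(3,3)` specimen (`s_two_eq_selfRep33`).

Relation to the tree: the PERIOD-1 companion of res-dim4-idea-3 / res-dim4-typ-1's coordinate cage (`…CoordinateCage`: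
`x₃^{p−1}(x₄ + εx₂ + x₂x₄) + x₁^p x₂`, period 2 at odd `p`, blind along the same kind of hyperbola graph) and of TRAP-1
(`…CoordinateTrap`, `p = 2`); `¬ TerminatesSomeRule p p` / `¬ Terminates1h p p` are theirs and are not restated.  Honest
increment: census/ZOO only («blind fixed points of the point blow-up exist at every exponent, over every field»).
bears_on: LADDER-RESOLUTION:D157-DOOR2 (res-dim4-pi · ZOO companion uniform in q).  Supports stmt-ResolutionOfSingularities-16155
(helper).
-/

set_option linter.dupNamespace false

open MvPolynomial Finset

open scoped BigOperators

noncomputable section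

namespace Summit.ResolutionOfSingularities.ResolutionOfSingularities.Theorems.PIDim4

namespace BlindFixedPoint

open Literature.AlgebraicGeometry.Resolution
open Literature.AlgebraicGeometry.Resolution.Hauser2010
open Literature.AlgebraicGeometry.Resolution.CentreBlowup

variable {K : Type} [Field K]

/-! ## §1 The objects -/

variable (K) in
/-- `g = x₂ − x₄ + x₂x₄`. [folklore] -/
def g : MvPolynomial (Fin 4) K := X 1 - X 3 + X 1 * X 3

variable (K) in
/-- `g' = 1 − x₄ + x₂x₄` (the `x₂`-chart image of `g` divided by `x₂`). [folklore] -/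
def g' : MvPolynomial (Fin 4) K := 1 - X 3 + X 1 * X 3

variable (K) in
/-- `A_n = x₃ · (x₁ⁿ + gⁿ)`, the state polynomial at the exponent `q = n + 1`. [folklore] -/
def A (n : ℕ) : MvPolynomial (Fin 4) K := X 2 * (X 0 ^ n + g K ^ n)

variable (K) in
/-- `A'_n = x₃ · (x₁ⁿ + g'ⁿ)`, its `x₂`-chart transform. [folklore] -/
def A' (n : ℕ) : MvPolynomial (Fin 4) K := X 2 * (X 0 ^ n + g' K ^ n)

variable (K) in
/-- The presented state `s_n = (A_n, 0, {x₂})`. [folklore] -/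
def s (n : ℕ) : State K := ⟨A K n, 0, {1}⟩

variable (K) in
/-- The fibre point `(0,0,0,1)` of the `x₂`-chart. [folklore] -/
def b : Fin 4 → K := ![0, 0, 0, 1]

/-- `b 0 = 0`. -/ @[simp] theorem b_zero : b K 0 = 0 := rfl
/-- `b 1 = 0`. -/ @[simp] theorem b_one : b K 1 = 0 := rfl
/-- `b 2 = 0`. -/ @[simp] theorem b_two : b K 2 = 0 := rfl
/-- `b 3 = 1`. -/ @[simp] theorem b_three : b K 3 = 1 := rfl

variable (K) in
/-- The ideal `Q = (x₁, x₃, g)` of the blind curve. [folklore] -/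
def Q : Ideal (MvPolynomial (Fin 4) K) := Ideal.span {X 0, X 2, g K}

/-! ## §2 Order and coefficients -/

/-- `A_n ∈ Q^{n+1}`. [folklore] -/
theorem A_mem_Q_pow (n : ℕ) : A K n ∈ Q K ^ (n + 1) := by
  have hX0 : (X 0 : MvPolynomial (Fin 4) K) ∈ Q K := Ideal.subset_span (by simp)
  have hX2 : (X 2 : MvPolynomial (Fin 4) K) ∈ Q K := Ideal.subset_span (by simp)
  have hg : g K ∈ Q K := Ideal.subset_span (by simp)
  have h1 : (X 0 ^ n + g K ^ n : MvPolynomial (Fin 4) K) ∈ Q K ^ n :=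
    Ideal.add_mem _ (Ideal.pow_mem_pow hX0 n) (Ideal.pow_mem_pow hg n)
  rw [A, pow_succ']
  exact Ideal.mul_mem_mul hX2 h1

/-- `Q ≤ 𝔪₀`. [folklore] -/
theorem Q_le_originIdeal : Q K ≤ originIdeal K := by
  unfold Q originIdeal
  rw [Ideal.span_le]
  intro x hx
  simp only [Set.mem_insert_iff, Set.mem_singleton_iff] at hx
  rcases hx with rfl | rfl | rfl <;> simp [RingHom.mem_ker, g]

/-- `A_n` has no monomial of degree `≤ n`. [folklore] -/
theorem coeff_A_of_degree_lt (n : ℕ) {d : Fin 4 →₀ ℕ} (hd : d.degree < n + 1) : coeff d (A K n) = 0 :=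
  (IsolationCert.mem_originIdeal_pow_iff (n + 1) (A K n)).mp
    (Ideal.pow_right_mono Q_le_originIdeal (n + 1) (A_mem_Q_pow n)) d hd

/-- Coefficients of `A_n` not involving `x_j` are read on `x_j ↦ 0`. [folklore] -/
theorem coeff_A_eq_coeff_killVar (n : ℕ) (j : Fin 4) {d : Fin 4 →₀ ℕ} (hd : d j = 0) :
    coeff d (A K n) = coeff d (PointBlowup.killVar j (A K n)) := by
  rw [ResCone.coeff_killVar, if_pos hd]

/-- `x₁^a x₃` and friends as monomials. [folklore] -/
theorem X_mul_X_pow_eq_monomial (i j : Fin 4) (a : ℕ) (c : K) :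
    (C c * (X i * X j ^ a) : MvPolynomial (Fin 4) K) = monomial (Finsupp.single i 1 + Finsupp.single j a) c := by
  rw [X_pow_eq_monomial, X, monomial_mul, one_mul, C_mul_monomial, mul_one]

/-- Killing `x₂` and `x₄` leaves `x₃x₁ⁿ` of `A_n` (`n ≥ 1`). [folklore] -/
theorem killVar_one_three_A {n : ℕ} (hn : 1 ≤ n) :
    PointBlowup.killVar 3 (PointBlowup.killVar 1 (A K n)) = C 1 * (X 2 * X 0 ^ n) := by
  have hn0 : n ≠ 0 := by omega
  unfold PointBlowup.killVar
  simp [A, g, map_mul, map_add, map_sub, map_pow, zero_pow hn0]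

/-- Killing `x₁` and `x₄` leaves `x₃x₂ⁿ` of `A_n` (`n ≥ 1`). [folklore] -/
theorem killVar_zero_three_A {n : ℕ} (hn : 1 ≤ n) :
    PointBlowup.killVar 3 (PointBlowup.killVar 0 (A K n)) = C 1 * (X 2 * X 1 ^ n) := by
  have hn0 : n ≠ 0 := by omega
  unfold PointBlowup.killVar
  simp [A, g, map_mul, map_add, map_sub, map_pow, zero_pow hn0]

/-- Killing `x₁` and `x₂` leaves `(−1)ⁿ x₃x₄ⁿ` of `A_n` (`n ≥ 1`). [folklore] -/
theorem killVar_one_zero_A {n : ℕ} (hn : 1 ≤ n) :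
    PointBlowup.killVar 0 (PointBlowup.killVar 1 (A K n)) = C ((-1) ^ n) * (X 2 * X 3 ^ n) := by
  have hn0 : n ≠ 0 := by omega
  unfold PointBlowup.killVar
  simp [A, g, map_mul, map_add, map_sub, map_pow, zero_pow hn0]
  ring

/-- The coefficient of `x₃x₁ⁿ` in `A_n` is `1` (`n ≥ 1`). [folklore] -/
theorem coeff_A_e02 {n : ℕ} (hn : 1 ≤ n) : coeff (Finsupp.single 2 1 + Finsupp.single 0 n) (A K n) = 1 := by
  classical
  rw [coeff_A_eq_coeff_killVar n 1 (by simp), ← (ResCone.coeff_killVar 3 _ _).trans (if_pos (by simp)),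
    killVar_one_three_A hn, X_mul_X_pow_eq_monomial, coeff_monomial, if_pos rfl]

/-- The coefficient of `x₃x₂ⁿ` in `A_n` is `1` (`n ≥ 1`). [folklore] -/
theorem coeff_A_e12 {n : ℕ} (hn : 1 ≤ n) : coeff (Finsupp.single 2 1 + Finsupp.single 1 n) (A K n) = 1 := by
  classical
  have hn0 : n ≠ 0 := by omega
  rw [coeff_A_eq_coeff_killVar n 0 (by simp), ← (ResCone.coeff_killVar 3 _ _).trans (if_pos (by simp)),
    killVar_zero_three_A hn, X_mul_X_pow_eq_monomial, coeff_monomial, if_pos rfl]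

/-- The coefficient of `x₃x₄ⁿ` in `A_n` is `(−1)ⁿ` (`n ≥ 1`). [folklore] -/
theorem coeff_A_e32 {n : ℕ} (hn : 1 ≤ n) :
    coeff (Finsupp.single 2 1 + Finsupp.single 3 n) (A K n) = (-1) ^ n := by
  classical
  have hn0 : n ≠ 0 := by omega
  rw [coeff_A_eq_coeff_killVar n 1 (by simp), ← (ResCone.coeff_killVar 0 _ _).trans (if_pos (by simp)),
    killVar_one_zero_A hn, X_mul_X_pow_eq_monomial, coeff_monomial, if_pos rfl]

/-- `A_n ≠ 0` (`n ≥ 1`). [folklore] -/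
theorem A_ne_zero {n : ℕ} (hn : 1 ≤ n) : A K n ≠ 0 := fun h => by
  have h1 := coeff_A_e02 (K := K) hn
  rw [h, coeff_zero] at h1
  exact zero_ne_one h1

/-- `ord_{(x₁,…,x₄)} A_n = n + 1` (`n ≥ 1`). [folklore] -/
theorem ordAlong_univ_A {n : ℕ} (hn : 1 ≤ n) : ordAlong Finset.univ (A K n) = (n + 1 : ℕ) := by
  apply le_antisymm
  · have h := ordAlong_le_of_coeff_ne_zero (S := Finset.univ) (d := Finsupp.single 2 1 + Finsupp.single 0 n)
      (F := A K n) (by rw [coeff_A_e02 hn]; exact one_ne_zero)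
    rw [Trap1.degIn_univ4] at h
    simpa [Finsupp.single_apply, add_comm] using h
  · refine le_ordAlong_of_forall fun d hd => ?_
    rw [degIn_univ]
    by_contra hlt
    exact (MvPolynomial.mem_support_iff.mp hd) (coeff_A_of_degree_lt n (by omega))

/-- `ord₀ A_n = n + 1` (`n ≥ 1`). [folklore] -/
theorem ordZero_A {n : ℕ} (hn : 1 ≤ n) : ordZero (A K n) = (n + 1 : ℕ) := by
  rw [← ordAlong_univ, ordAlong_univ_A hn]

/-! ## §3 The point is the only permissible coordinate centre -/

/-- Along every coordinate triple the order of `A_n` is `≤ n < n + 1`. [folklore] -/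
theorem ordAlong_erase_lt {n : ℕ} (hn : 1 ≤ n) (i : Fin 4) :
    ordAlong (Finset.univ.erase i) (A K n) < (n + 1 : ℕ) := by
  have hlt1 : ((1 : ℕ) : ℕ∞) < ((n + 1 : ℕ) : ℕ∞) := by exact_mod_cast (show 1 < n + 1 by omega)
  have hltn : ((n : ℕ) : ℕ∞) < ((n + 1 : ℕ) : ℕ∞) := by exact_mod_cast (show n < n + 1 by omega)
  have hm1 : ((-1 : K) ^ n) ≠ 0 := pow_ne_zero _ (neg_ne_zero.mpr one_ne_zero)
  fin_cases i
  · have hT : (Finset.univ : Finset (Fin 4)).erase 0 = Trap1.T0 := by decide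
    have h := ordAlong_le_of_coeff_ne_zero (S := Trap1.T0) (d := Finsupp.single 2 1 + Finsupp.single 0 n) (F := A K n)
      (by rw [coeff_A_e02 hn]; exact one_ne_zero)
    rw [Trap1.degIn_T0] at h
    refine lt_of_le_of_lt ?_ hlt1
    simpa [hT, Finsupp.single_apply] using h
  · have hT : (Finset.univ : Finset (Fin 4)).erase 1 = Trap1.T1 := by decide
    have h := ordAlong_le_of_coeff_ne_zero (S := Trap1.T1) (d := Finsupp.single 2 1 + Finsupp.single 1 n) (F := A K n)
      (by rw [coeff_A_e12 hn]; exact one_ne_zero)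
    rw [Trap1.degIn_T1] at h
    refine lt_of_le_of_lt ?_ hlt1
    simpa [hT, Finsupp.single_apply] using h
  · have hT : (Finset.univ : Finset (Fin 4)).erase 2 = Trap1.T2 := by decide
    have h := ordAlong_le_of_coeff_ne_zero (S := Trap1.T2) (d := Finsupp.single 2 1 + Finsupp.single 0 n) (F := A K n)
      (by rw [coeff_A_e02 hn]; exact one_ne_zero)
    rw [Trap1.degIn_T2] at h
    refine lt_of_le_of_lt ?_ hltn
    simpa [hT, Finsupp.single_apply] using h
  · have hT : (Finset.univ : Finset (Fin 4)).erase 3 = Trap1.T3 := by decide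
    have h := ordAlong_le_of_coeff_ne_zero (S := Trap1.T3) (d := Finsupp.single 2 1 + Finsupp.single 3 n) (F := A K n)
      (by rw [coeff_A_e32 hn]; exact hm1)
    rw [Trap1.degIn_T3] at h
    refine lt_of_le_of_lt ?_ hlt1
    simpa [hT, Finsupp.single_apply] using h

/-- **The point is the only Hironaka-permissible coordinate centre of `A_n`** (`q = n + 1`, `n ≥ 1`). [folklore] -/
theorem eq_univ_of_isPermissibleCentre {n : ℕ} (hn : 1 ≤ n) {S : Finset (Fin 4)}
    (h : IsPermissibleCentre (n + 1) S (A K n)) : S = Finset.univ := by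
  by_contra hS
  obtain ⟨i, hi⟩ : ∃ i, i ∉ S := by
    by_contra hall
    push Not at hall
    exact hS (Finset.eq_univ_iff_forall.mpr hall)
  have hsub : S ⊆ Finset.univ.erase i := fun k hk =>
    Finset.mem_erase.mpr ⟨fun hki => hi (hki ▸ hk), Finset.mem_univ k⟩
  have h2 := lt_of_le_of_lt (le_trans h.2 (ordAlong_mono hsub (A K n))) (ordAlong_erase_lt hn i)
  exact lt_irrefl _ (by exact_mod_cast h2)

/-- The point is Hironaka-permissible at `A_n`. [folklore] -/
theorem isPermissibleCentre_univ {n : ℕ} (hn : 1 ≤ n) : IsPermissibleCentre (n + 1) Finset.univ (A K n) :=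
  ⟨Finset.univ_nonempty, by rw [ordAlong_univ_A hn]⟩

/-- … hence the MODE-1h centre. [folklore] -/
theorem isMode1hCentre_univ {n : ℕ} (hn : 1 ≤ n) : IsMode1hCentre (n + 1) Finset.univ (A K n) :=
  ⟨isPermissibleCentre_univ hn, fun S' hS' => by rw [eq_univ_of_isPermissibleCentre hn hS']⟩

/-! ## §4 Self-reproduction, letter for letter -/

/-- The chart substitution `φ` (`x₂ ↦ x₂`, `xᵢ ↦ x₂xᵢ`) sends `g` to `x₂ · g'`. [folklore] -/
theorem aeval_chart_g :
    MvPolynomial.aeval (fun i => if i = (1 : Fin 4) then (X 1 : MvPolynomial (Fin 4) K) else X 1 * X i) (g K) =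
      X 1 * g' K := by
  simp [g, g']
  ring

/-- The total transform of `A_n` in the `x₂`-chart is `x₂^{n+1} · A'_n`. [folklore] -/
theorem aeval_chart_A (n : ℕ) :
    MvPolynomial.aeval (fun i => if i = (1 : Fin 4) then (X 1 : MvPolynomial (Fin 4) K) else X 1 * X i) (A K n) =
      X 1 ^ (n + 1) * A' K n := by
  have h0 : MvPolynomial.aeval (fun i => if i = (1 : Fin 4) then (X 1 : MvPolynomial (Fin 4) K) else X 1 * X i)
      (X 0 : MvPolynomial (Fin 4) K) = X 1 * X 0 := by simp
  have h2 : MvPolynomial.aeval (fun i => if i = (1 : Fin 4) then (X 1 : MvPolynomial (Fin 4) K) else X 1 * X i)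
      (X 2 : MvPolynomial (Fin 4) K) = X 1 * X 2 := by simp
  rw [A, map_mul, map_add, map_pow, map_pow, h0, h2, aeval_chart_g, A', mul_pow, mul_pow]
  ring

/-- **The `x₂`-chart transform of `A_n` is `A'_n = x₃(x₁ⁿ + (1 − x₄ + x₂x₄)ⁿ)`.** [folklore] -/
theorem chartTransform_A {n : ℕ} (hn : 1 ≤ n) : chartTransform (n + 1) Finset.univ 1 (A K n) = A' K n := by
  rw [chartTransform_univ]
  have h := PointBlowup.X_pow_mul_chartTransform (K := K) (1 : Fin 4) (a := n + 1) (P := A K n)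
    (by rw [ordZero_A hn])
  rw [aeval_chart_A] at h
  exact mul_left_cancel₀ (pow_ne_zero _ (X_ne_zero (1 : Fin 4))) h

/-- **The translation `x₄ ↦ x₄ + 1` sends `A'_n` back to `A_n`.** [folklore] -/
theorem translate_A' (n : ℕ) : PointBlowup.translate (b K) (A' K n) = A K n := by
  simp only [PointBlowup.translate, A, A', g, g', map_add, map_mul, map_pow, map_sub, map_one, MvPolynomial.aeval_X,
    b_zero, b_one, b_two, b_three, map_zero, add_zero, map_one]
  ring

/-- The second factor `x₁ⁿ + gⁿ` does not involve `x₃`. [folklore] -/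
theorem killVar_two_H (n : ℕ) :
    PointBlowup.killVar 2 (X 0 ^ n + g K ^ n : MvPolynomial (Fin 4) K) = X 0 ^ n + g K ^ n := by
  unfold PointBlowup.killVar
  simp [g]

/-- Every monomial of `A_n` has `x₃`-exponent `1`. [folklore] -/
theorem apply_two_eq_one_of_mem_support (n : ℕ) {d : Fin 4 →₀ ℕ} (hd : d ∈ (A K n).support) : d 2 = 1 := by
  classical
  have hc := MvPolynomial.mem_support_iff.mp hd
  rw [A, coeff_X_mul'] at hc
  by_cases h2 : (2 : Fin 4) ∈ d.support
  · rw [if_pos h2] at hc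
    have hd2 : d 2 ≠ 0 := Finsupp.mem_support_iff.mp h2
    have he2 : (d - Finsupp.single (2 : Fin 4) 1 : Fin 4 →₀ ℕ) 2 = 0 := by
      by_contra hne
      rw [← killVar_two_H n, ResCone.coeff_killVar, if_neg hne] at hc
      exact hc rfl
    rw [Finsupp.tsub_apply, Finsupp.single_eq_same] at he2
    omega
  · rw [if_neg h2] at hc
    exact absurd rfl hc

/-- **Cleaning is inert on `A_n`** (`n ≥ 1`: no monomial is an `(n+1)`-th power). [folklore] -/
theorem deletePthPowers_A {n : ℕ} (hn : 1 ≤ n) : deletePthPowers (n + 1) (A K n) = A K n :=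
  PthPowerFactor.deletePthPowers_eq_self_of_forall (n + 1) _ fun d hd h => by
    have h1 := apply_two_eq_one_of_mem_support n hd
    have := (isPthPowerExponent_iff (n + 1) d).mp h 2
    rw [h1] at this
    have := Nat.le_of_dvd one_pos this
    omega

variable [DecidableEq K]

omit [DecidableEq K] in
/-- The translated transform of `s_n` at `(0,0,0,1)` in the `x₂`-chart is `A_n` itself. [folklore] -/
theorem pointTransform_s {n : ℕ} (hn : 1 ≤ n) : pointTransform (n + 1) Finset.univ 1 (b K) (s K n) = A K n := by
  rw [pointTransform, show (s K n).F = A K n from rfl, chartTransform_A hn, translate_A']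

omit [DecidableEq K] in
/-- `(0,0,0,1)` is an equimultiple point. [folklore] -/
theorem isEquimultiplePoint_s {n : ℕ} (hn : 1 ≤ n) : IsEquimultiplePoint (n + 1) Finset.univ 1 (b K) (s K n) :=
  fun d _ hdeg => by rw [pointTransform_s hn]; exact coeff_A_of_degree_lt n hdeg

/-- Updating the zero exponent at `1` with `0` gives zero. -/
private theorem update_one_zero : (0 : Fin 4 →₀ ℕ).update 1 0 = 0 := by
  ext i; rw [Finsupp.update_apply]; split_ifs <;> rfl

/-- **Self-reproduction**: `step (n+1) univ x₂ (0,0,0,1) s_n = s_n`, letter for letter (`n ≥ 1`). [folklore] -/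
theorem step_s {n : ℕ} (hn : 1 ≤ n) : CentreBlowup.step (n + 1) Finset.univ 1 (b K) (s K n) = s K n := by
  have hF : deletePthPowers (n + 1) (pointTransform (n + 1) Finset.univ 1 (b K) (s K n)) = A K n := by
    rw [pointTransform_s hn, deletePthPowers_A hn]
  have hr : newMult (n + 1) Finset.univ 1 (b K) (s K n) = 0 := by
    unfold newMult
    have hfil : ((s K n).r.filter fun i => b K i = 0) = 0 := by
      rw [show (s K n).r = 0 from rfl, Finsupp.filter_zero]
    rw [hfil, show (s K n).F = A K n from rfl, ordAlong_univ_A hn]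
    simp only [ENat.toNat_coe, Nat.sub_self]
    exact update_one_zero
  have he : newExc 1 (b K) (s K n) = ({1} : Finset (Fin 4)) := by
    unfold newExc
    rw [show (s K n).exc = {1} from rfl, Finset.filter_singleton, if_pos b_one]
    exact Finset.insert_eq_of_mem (Finset.mem_singleton_self 1)
  unfold CentreBlowup.step
  rw [hF, hr, he]; rfl

/-- The loop edge along the point. [folklore] -/
theorem edge_s {n : ℕ} (hn : 1 ≤ n) : Edge (n + 1) Finset.univ (s K n) (s K n) :=
  ⟨1, b K, Finset.mem_univ _, b_one, isEquimultiplePoint_s hn, by rw [step_s hn]; exact A_ne_zero hn, (step_s hn).symm⟩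

/-- It is a MODE-0 step. [folklore] -/
theorem step0_s {n : ℕ} (hn : 1 ≤ n) : Step0 (n + 1) (s K n) (s K n) :=
  ⟨(isPermissibleCentre_univ hn).2, edge_s hn⟩

/-- It is a MODE-1h step. [folklore] -/
theorem step1h_s {n : ℕ} (hn : 1 ≤ n) : Step1h (n + 1) (s K n) (s K n) :=
  ⟨Finset.univ, isMode1hCentre_univ hn, edge_s hn⟩

/-- Every permissible coordinate rule loops at `s_n`. [folklore] -/
theorem stepRule_s {n : ℕ} (hn : 1 ≤ n) (R : CentreRule K) (hR : IsPermissibleRule (n + 1) R) :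
    StepRule (n + 1) R (s K n) (s K n) := by
  have hperm : IsPermissibleCentre (n + 1) (R (s K n)) (s K n).F := hR _ ⟨Finset.univ, isPermissibleCentre_univ hn⟩
  refine ⟨hperm, ?_⟩
  rw [eq_univ_of_isPermissibleCentre hn hperm]
  exact edge_s hn

/-- **`{s_n}` is a one-state trap at the exponent `n + 1`.** [folklore] -/
theorem isTrap_singleton {n : ℕ} (hn : 1 ≤ n) : IsTrap (n + 1) ({s K n} : Set (State K)) := by
  intro x hx
  rw [Set.mem_singleton_iff] at hx
  subst hx
  refine ⟨(isPermissibleCentre_univ hn).2, fun S hS => ⟨s K n, rfl, ?_⟩⟩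
  rw [eq_univ_of_isPermissibleCentre hn hS]
  exact edge_s hn

end BlindFixedPoint

end Summit.ResolutionOfSingularities.ResolutionOfSingularities.Theorems.PIDim4

end
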